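import Mathlib
import HarnessLib
import Summits.NavierStokesRegularity.NavierStokesRegularity.Theses.RellichScar
import Literature.Analysis.FluidPDE.SuitableWeak
import Literature.Analysis.FluidPDE.SelfSimilar
import Literature.Analysis.FluidPDE.LocalTypeI
import Literature.Analysis.FluidPDE.ESSLocalHolderNoConcentration
import Summits.NavierStokesRegularity.NavierStokesRegularity.Theorems.RellichScarApexLocalisationTracelessConeLiouville
import Summits.NavierStokesRegularity.NavierStokesRegularity.Theorems.RellichScarApexLocalisationTracelessHalfspaceLiouville
import Summits.NavierStokesRegularity.NavierStokesRegularity.Theorems.RellichScarApexLocalisationTracelessConeLiouvilleLiSverak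
import Summits.NavierStokesRegularity.NavierStokesRegularity.Theorems.RellichScarApexLocalisationFaintOfCalmBoundedTrace
import Summits.NavierStokesRegularity.NavierStokesRegularity.Theorems.RellichScarApexLocalisationHalfspaceScarFloor
import Summits.NavierStokesRegularity.NavierStokesRegularity.Theorems.RellichScarApexLocalisationTameSide

/-!
# Skeleton — crux `ApexLocalisation` (stmt-NavierStokesRegularity-11719), line `line-calm-cone-carleman`, lead a3

`ApexLocalisation_of` proves `Summit.NavierStokesRegularity.NavierStokesRegularity.Theses.RellichScar.ApexLocalisation`
from the registered stubs below.  The line (idea `calm-cone-carleman`, round 2): a Type-I RATE singular point of a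
suitable weak slab solution with `𝐈 < ⊤` has NO tame side — it cannot be parabolically `o(1/‖x‖)` ("scar-faint") on
an open half-space through the point (S_A, unconditional: K1′ = `stub_tracelessConeLiouville` p126951 at `κ = 0`, the
backward-uniqueness input discharged by ESS 2003 Thm 5.1 = `Carleman.backwardUniqueness_uncurried_c12`), nor on a cone
of opening `> 109.5°` given Li–Šverák's cone backward uniqueness (S_L, conditional on the named fact
`coneBackwardUniquenessC12`), and "apex-calm with a bounded final trace on a cone" already forces faintness on every
narrower cone (S_B), so a calm side with bounded scar on a wider-than-half-space cone is impossible too.  The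
quantitative contrapositive of S_A over the compact class `𝐈 ≤ I` is the scar floor S_C.

Stubs (registered on the crux item; one `sorry` each; workers land them `--supports`):
* S_A `stub_tracelessHalfspaceLiouville` — K1′ at `κ = 0` + ESS Thm 5.1;
* S_L `stub_tracelessConeLiouvilleOfLiSverak` — K1′ for `0 ≤ κ < 1/√3` under `coneBackwardUniquenessC12`;
* S_B `stub_faintOfCalmBoundedTrace` — calm + bounded trace on `Γ_κ(e)` ⇒ faint on `Γ_κ'(e)`, `κ < κ'`
  (Serrin interior regularity `NSBoundedHigherRegularityBounds_holds` at scale `‖x‖`: Hölder modulus in time up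
  to the final slice);
* S_C `stub_halfspaceScarFloor` — uniform `ε₀(C, η, I) > 0` (compactness `slab_typeI_compactness_sharp` +
  representatives `exists_rate_profile_repr` + S_A);
* THE BET `stub_tameSideSelection` — every origin-singular rate profile (`𝐈 < ⊤`) yields an origin-singular apex
  profile OR an origin-singular rate profile with a tame side (faint half-space, or calm + bounded trace on a cone
  `Γ_κ`, `κ < 0`, with a continuous representative).  Crux-like (implied by the crux; (L)-vacuous; Disproof §10).

The composition kills the tame alternatives with S_A and S_B + S_A.
-/

noncomputable section

set_option linter.dupNamespace false

namespace Summit.NavierStokesRegularity.NavierStokesRegularity.Theorems.RellichScarApexLocalisation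

open MeasureTheory Set Function Metric Filter Topology TopologicalSpace
open scoped ENNReal NNReal InnerProductSpace RealInnerProductSpace
open Literature.Analysis Literature.Analysis.FluidPDE

local notation "E³" => EuclideanSpace ℝ (Fin 3)

/-- The open backward slab `(-∞, 0) × ℝ³` (time first). -/
local notation "𝕊" => Literature.Analysis.FluidPDE.slab (EuclideanSpace ℝ (Fin 3)) (Set.Iio (0 : ℝ)) isOpen_Iio

/-! ### Landed stubs (wave 1, lead a3)

* S_A `stub_tracelessHalfspaceLiouville` — p130873, `Theorems/RellichScarApexLocalisationTracelessHalfspaceLiouville.lean`;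
* S_L `stub_tracelessConeLiouvilleOfLiSverak` — p131153 (named fact `Literature.Analysis.FluidPDE.coneBackwardUniquenessC12`
  = Li–Šverák 2012 Thm 1.1, p131152, `Literature/Analysis/FluidPDE/ConeBackwardUniqueness.lean`),
  `Theorems/RellichScarApexLocalisationTracelessConeLiouvilleLiSverak.lean`;
* S_B `stub_faintOfCalmBoundedTrace` — p131380, `Theorems/RellichScarApexLocalisationFaintOfCalmBoundedTrace.lean`;
* S_C `stub_halfspaceScarFloor` — p131124, `Theorems/RellichScarApexLocalisationHalfspaceScarFloor.lean`.

They are imported above and used below by name. -/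

example := @stub_tracelessHalfspaceLiouville
example := @stub_tracelessConeLiouvilleOfLiSverak
example := @stub_faintOfCalmBoundedTrace
example := @stub_halfspaceScarFloor

/-! ### THE BET — tame-side selection -/

/-- **THE BET (stub_tameSideSelection).** Every origin-singular rate-Type-I suitable weak slab solution with
`𝐈 < ⊤` yields EITHER an origin-singular APEX profile (the crux' conclusion) OR an origin-singular rate profile with
a TAME SIDE: scar-faint on an open half-space through the origin, or (with a continuous representative) apex-calm
with bounded final trace on a cone `{κ‖x‖ < ⟪x,e⟫}` with `κ < 0`.  Crux-like: implied by the crux (first disjunct),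
(L)-vacuous and irrefutable short of a Type-I blow-up (Disproof §10, `not_apexLocalisation_iff`); the two tame
alternatives are EMPTY classes by S_A and S_B + S_A, so the bet is the crux in the Type-I world. -/
theorem stub_tameSideSelection :
    ∀ C : ℝ, (∃ (u : ℝ → E³ → E³) (p : ℝ → E³ → ℝ) (G : ℝ → E³ → E³ →L[ℝ] E³),
        IsSuitableWeakSolutionOn 𝕊 1 0 u p ∧ HasWeakSpatialGradientOn 𝕊 u G ∧
        typeIBound (Set.Iio (0 : ℝ) ×ˢ Set.univ) u p G < ⊤ ∧ HasTypeITimeDecay C u ∧ IsBackwardSingularPoint u 0) →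
      (∃ (C' : ℝ) (u : ℝ → E³ → E³) (p : ℝ → E³ → ℝ) (G : ℝ → E³ → E³ →L[ℝ] E³),
        IsSuitableWeakSolutionOn 𝕊 1 0 u p ∧ HasWeakSpatialGradientOn 𝕊 u G ∧
        typeIBound (Set.Iio (0 : ℝ) ×ˢ Set.univ) u p G < ⊤ ∧ HasTypeIDecay C' u ∧ IsBackwardSingularPoint u 0) ∨
      (∃ (C₁ : ℝ) (e : E³) (u : ℝ → E³ → E³) (p : ℝ → E³ → ℝ) (G : ℝ → E³ → E³ →L[ℝ] E³),
        ‖e‖ = 1 ∧ IsSuitableWeakSolutionOn 𝕊 1 0 u p ∧ HasWeakSpatialGradientOn 𝕊 u G ∧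
        typeIBound (Set.Iio (0 : ℝ) ×ˢ Set.univ) u p G < ⊤ ∧ HasTypeITimeDecay C₁ u ∧ IsBackwardSingularPoint u 0 ∧
        (∀ ε : ℝ, 0 < ε → ∃ δ : ℝ, 0 < δ ∧ ∃ η : ℝ, 0 < η ∧ ∀ x : E³, 0 < ⟪x, e⟫ → ‖x‖ < δ →
          ∀ t : ℝ, -η * ‖x‖ ^ 2 < t → t < 0 → ‖x‖ * ‖u t x‖ ≤ ε)) ∨
      (∃ (C₁ κ K B δ₀ : ℝ) (e : E³) (u : ℝ → E³ → E³) (p : ℝ → E³ → ℝ) (G : ℝ → E³ → E³ →L[ℝ] E³),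
        κ < 0 ∧ ‖e‖ = 1 ∧ 0 < δ₀ ∧ IsSuitableWeakSolutionOn 𝕊 1 0 u p ∧ HasWeakSpatialGradientOn 𝕊 u G ∧
        typeIBound (Set.Iio (0 : ℝ) ×ˢ Set.univ) u p G < ⊤ ∧ HasTypeITimeDecay C₁ u ∧ IsBackwardSingularPoint u 0 ∧
        ContinuousOn (Function.uncurry u) (Set.Iio (0 : ℝ) ×ˢ Set.univ) ∧
        (∀ t : ℝ, t < 0 → ∀ x : E³, κ * ‖x‖ < ⟪x, e⟫ → ‖u t x‖ ≤ K / (‖x‖ + Real.sqrt (-t))) ∧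
        (∀ x : E³, κ * ‖x‖ < ⟪x, e⟫ → ‖x‖ < δ₀ → ∀ᶠ t in nhdsWithin (0 : ℝ) (Set.Iio 0), ‖u t x‖ ≤ B)) := by
  sorry

/-! ### Landed by-product stubs (lead a3, p131709, `Theorems/RellichScarApexLocalisationTameSide.lean`)

* `stub_calmBoundedTraceNotSingular` — calm + bounded final trace on a reflex cone (`κ < 0`) ⇒ not singular (S_B + S_A), and on
  every cone `κ < 1/√3` under `coneBackwardUniquenessC12` (S_B + S_L);
* `stub_apexTraceUnboundedReflexCone` — a continuous apex profile singular at the origin has unbounded scar in every reflex cone;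
* `stub_cruxIffTameSideSelection` — the certificate crux ⇔ bet. -/

example := @stub_calmBoundedTraceNotSingular
example := @stub_apexTraceUnboundedReflexCone
example := @stub_cruxIffTameSideSelection

/-! ### The composition -/

/-- **Calm with bounded final trace on a wider-than-half-space cone is not singular** (the landed
`stub_calmBoundedTraceNotSingular` (i): S_B with `κ < κ' = 0`, then S_A). -/
theorem calmBoundedTrace_halfspace_notSingular
    {C κ K B δ₀ : ℝ} {e : E³} {u : ℝ → E³ → E³} {p : ℝ → E³ → ℝ} {G : ℝ → E³ → E³ →L[ℝ] E³}
    (hκ : κ < 0) (he : ‖e‖ = 1) (hδ₀ : 0 < δ₀)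
    (hsw : IsSuitableWeakSolutionOn 𝕊 1 0 u p) (hwg : HasWeakSpatialGradientOn 𝕊 u G)
    (hI : typeIBound (Set.Iio (0 : ℝ) ×ˢ Set.univ) u p G < ⊤) (hrate : HasTypeITimeDecay C u)
    (hcont : ContinuousOn (Function.uncurry u) (Set.Iio (0 : ℝ) ×ˢ Set.univ))
    (hcalm : ∀ t : ℝ, t < 0 → ∀ x : E³, κ * ‖x‖ < ⟪x, e⟫ → ‖u t x‖ ≤ K / (‖x‖ + Real.sqrt (-t)))
    (htrace : ∀ x : E³, κ * ‖x‖ < ⟪x, e⟫ → ‖x‖ < δ₀ → ∀ᶠ t in nhdsWithin (0 : ℝ) (Set.Iio 0), ‖u t x‖ ≤ B) :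
    ¬ IsBackwardSingularPoint u 0 :=
  stub_calmBoundedTraceNotSingular.1 C κ K B δ₀ e hκ he hδ₀ u p G hsw hwg hI hrate hcont hcalm htrace

/-- **The crux from the stubs**: the bet produces an apex profile (done), or an origin-singular rate profile faint
on a half-space (impossible by S_A), or one calm with bounded trace on a cone `Γ_κ`, `κ < 0` (impossible by S_B and
S_A). -/
theorem ApexLocalisation_of :
    Summit.NavierStokesRegularity.NavierStokesRegularity.Theses.RellichScar.ApexLocalisation := by
  intro C h
  rcases stub_tameSideSelection C h with hapex | hfaint | hcalm
  · exact hapex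
  · obtain ⟨C₁, e, u, p, G, he, hsw, hwg, hI, hrate, hsing, hf⟩ := hfaint
    exact absurd hsing (stub_tracelessHalfspaceLiouville C₁ e he u p G hsw hwg hI hrate hf)
  · obtain ⟨C₁, κ, K, B, δ₀, e, u, p, G, hκ, he, hδ₀, hsw, hwg, hI, hrate, hsing, hcont, hc, htr⟩ := hcalm
    exact absurd hsing (calmBoundedTrace_halfspace_notSingular hκ he hδ₀ hsw hwg hI hrate hcont hc htr)

end Summit.NavierStokesRegularity.NavierStokesRegularity.Theorems.RellichScarApexLocalisation

end
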